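/-
Origin: expansion seat `planner-pub-hodgecm-prl1-g3-0`, handover #13 v2 2026-08-18T06:41:58Z (`HOME/pub-hodgecm-prl1-g3/lean/Prl1g3/GoursatPairing.lean`, md5 9ed0025f, 304 lines);
landed by the gen-7 packager in gate run 25 as `HodgeCM/Automorphic/GoursatPairing.lean` (verbatim).
-/
/-
Origin: expansion seat `planner-pub-hodgecm-prl1-g3-0` (unit pub-hodgecm-prl1-g3, EXPANSION PROVER a-1 gen 3, CONSTRUCT),
2026-08-18.  Suggested target: `HodgeCM/Automorphic/GoursatPairing.lean` (module `HodgeCM.Automorphic.GoursatPairing`;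
ADDITIVE — nothing landed is replaced; imports ONLY the landed `HodgeCM.Automorphic.MatrixCoefficients`, v1 decls).
-/
import Summits.HodgeConjecture.HodgeCM.Automorphic.MatrixCoefficients

/-!
# Goursat pairing: matrix coefficients across a finite orthogonal sum of inequivalent irreducibles

Kernel lemmas for the (I5) `Translate` step of the REDUCE lineage (prl2-g4, GAPS `prl2g4-M5` (b)), in the precise
shape requested there (STATUS 2026-08-18T06:29:05Z): the pairing vectors `u = e₁c₁`, `u' = e₁d₁` are NOT inside one
irreducible — they lie in a finite orthogonal sum `⊕ᵢ Vᵢ` of pairwise NON-equivalent irreducible subrepresentations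
(the twist classes `[π ⊗ ψ∘det]`, multiplicity one entering only as "pairwise non-equivalent"), with every component
of `u'` non-zero; and the transfer of a non-vanishing matrix coefficient to a RATIONAL group element is POINTWISE
(a non-zero value at `g` forces `g` into a double coset `K'γK` of stabilisers), not a global decomposition
`G = K'·Λ·K`.

Main results (`R` unitary where stated; all KERNEL, over the isotypic-decomposition API of
`HodgeCM.Automorphic.IsotypicDecomposition` / `DiscreteDecomposition` / `MatrixCoefficients`):

* `IsIrreducible.orthogonal_or_exists_equiv_le` — **generalised Schur dichotomy**: an irreducible `V` and a closed
  invariant `W` are either orthogonal, or `W` contains an irreducible subrepresentation equivalent to `V`.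
* `mem_of_mem_closure_sup_of_mem_orthogonal` — Hilbert-space lemma: for `V` complete and `V ⟂ W`, a vector of
  `closure (V ⊔ W)` orthogonal to `W` lies in `V`.
* `le_cyclic_sum`, `cyclic_sum_eq` — **Goursat**: for `V : ι → Submodule ℂ H` (finite `ι`) irreducible, pairwise
  orthogonal, pairwise non-equivalent and `u' = ∑ cᵢ` with `cᵢ ∈ Vᵢ` all non-zero, the closed `G`-span of `u'` is
  `closure (⨆ Vᵢ)` (every `Vⱼ` lies in it).
* `exists_inner_orbit_ne_zero_of_mem_cyclic` — a non-zero vector of the closed `G`-span of `u'` pairs non-trivially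
  with some translate of `u'`; `exists_inner_orbit_sum_ne_zero` — hence so does every non-zero
  `u ∈ closure (⨆ Vᵢ)`.
* `exists_mem_inner_orbit_ne_zero_of_support` — **pointwise support transfer**: if every `g` with
  `⟪R g u', u⟫ ≠ 0` factors as `k'γk` with `γ ∈ Λ`, `k` fixing `u'`, `k'` fixing `u`, then some `γ ∈ Λ` pairs;
  `exists_mem_inner_orbit_sum_ne_zero_of_support` — the combination.

References for the mathematics: the dichotomy is Schur's lemma for unitary representations [Getz–Hahn 2024, §3,
Def 3.1 p. 54 and the discussion of intertwiners]; "Goursat" is the standard description of subrepresentations of a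
finite sum of pairwise inequivalent irreducibles.  Nothing here is specific to theta series.
-/

noncomputable section

open scoped InnerProductSpace ComplexOrder
open HodgeCM.PerL34 HodgeCM.PerL34.Spectral

namespace HodgeCM
namespace RepDecomp

variable {H : Type*} [NormedAddCommGroup H] [InnerProductSpace ℂ H] [CompleteSpace H]
variable {G : Type*} [Group G] {R : G →* (H →L[ℂ] H)}

/-! ## 1. Generalised Schur dichotomy -/

/-- **Generalised Schur dichotomy.**  An irreducible subrepresentation `V` and a closed invariant subspace `W` of a
unitary representation are either ORTHOGONAL, or `W` contains an irreducible subrepresentation `V'` unitarily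
equivalent to `V` (the image of the polar part of the intertwiner `P_W|_V`). -/
theorem IsIrreducible.orthogonal_or_exists_equiv_le (hR : IsUnitaryRep R) {V W : Submodule ℂ H}
    (hV : IsIrreducible R V) (hWc : IsClosed (W : Set H)) (hW : Invariant R W) :
    V ⟂ W ∨ ∃ V' : Submodule ℂ H, V' ≤ W ∧ IsIrreducible R V' ∧ Equiv R V V' := by
  haveI : CompleteSpace V := hV.isClosed.completeSpace_coe
  haveI : CompleteSpace W := hWc.completeSpace_coe
  have hρ := hV.schurIrreducible hR
  set ρ := subRep hR V hV.isClosed hV.invariant with hρdef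
  set T : V →L[ℂ] H := W.starProjection ∘L V.subtypeL with hTdef
  have hTapply : ∀ v : V, T v = W.starProjection (v : H) := fun v => rfl
  have hT : Schur.Intertwines ρ (toUnitary hR) T := by
    intro g
    ext v
    show W.starProjection (R g (v : H)) = R g (W.starProjection (v : H))
    exact (congrArg (fun S : H →L[ℂ] H => S (v : H)) (hW.starProjection_commute hR g)).symm
  by_cases h0 : T = 0
  · left
    rw [Submodule.isOrtho_iff_le]
    intro v hv
    have h1 : W.starProjection v = 0 := by
      have := congrArg (fun S : V →L[ℂ] H => S ⟨v, hv⟩) h0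
      simpa [hTapply] using this
    exact W.starProjection_apply_eq_zero_iff.mp h1
  · right
    obtain ⟨U, ⟨a, _, hUa⟩, hU⟩ := Schur.exists_linearIsometry_of_intertwiner_ne_zero hρ hT h0
    have hUW : ∀ x, U x ∈ W := fun x => by
      rw [hUa x, hTapply]
      exact W.smul_mem _ (W.starProjection_apply_mem _)
    have hU' : ∀ (g : G) (v v' : V), (v' : H) = R g v → U v' = R g (U v) := fun g v v' hv' => by
      have hvv : v' = ((ρ g : unitary (V →L[ℂ] V)) : V →L[ℂ] V) v := Subtype.ext (hv'.trans rfl)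
      rw [hvv]
      exact hU g v
    refine ⟨LinearMap.range U.toLinearMap, ?_, hV.range_of_isometry U hU'⟩
    rintro _ ⟨x, rfl⟩
    exact hUW x

/-! ## 2. A Hilbert-space lemma -/

omit [CompleteSpace H] in
/-- For `V` complete and `V ⟂ W`: a vector of the closure of `V ⊔ W` that is orthogonal to `W` lies in `V`. -/
theorem mem_of_mem_closure_sup_of_mem_orthogonal {V W : Submodule ℂ H} [V.HasOrthogonalProjection] (hVW : V ⟂ W)
    {x : H} (hx : x ∈ (V ⊔ W).topologicalClosure) (hxW : x ∈ Wᗮ) : x ∈ V := by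
  set P := V.starProjection with hP
  have h1 : ∀ y ∈ V ⊔ W, y - P y ∈ W := by
    intro y hy
    obtain ⟨a, ha, b, hb, rfl⟩ := Submodule.mem_sup.mp hy
    have hPa : P a = a := Submodule.starProjection_eq_self_iff.mpr ha
    have hPb : P b = 0 := by
      rw [hP, Submodule.starProjection_apply_eq_zero_iff]
      exact Submodule.isOrtho_iff_le.mp hVW.symm hb
    rw [map_add, hPa, hPb, add_zero, add_sub_cancel_left]
    exact hb
  have h2 : x - P x ∈ W.topologicalClosure := by
    let f : H →L[ℂ] H := ContinuousLinearMap.id ℂ H - P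
    have hle : V ⊔ W ≤ (W.topologicalClosure).comap (f : H →ₗ[ℂ] H) := fun y hy =>
      W.le_topologicalClosure (h1 y hy)
    have hc : IsClosed (((W.topologicalClosure).comap (f : H →ₗ[ℂ] H) : Submodule ℂ H) : Set H) :=
      W.isClosed_topologicalClosure.preimage f.continuous
    exact (Submodule.topologicalClosure_minimal _ hle hc) hx
  have hWc : W.topologicalClosure ≤ Wᗮᗮ :=
    Submodule.topologicalClosure_minimal _ W.le_orthogonal_orthogonal (Submodule.isClosed_orthogonal _)
  have hWo : Wᗮ ≤ W.topologicalClosureᗮ := by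
    intro y hy
    refine Submodule.orthogonal_le hWc ?_
    rwa [Submodule.triorthogonal_eq_orthogonal]
  have hz : x - P x ∈ W.topologicalClosureᗮ :=
    Submodule.sub_mem _ (hWo hxW) (hWo (Submodule.isOrtho_iff_le.mp hVW (V.starProjection_apply_mem x)))
  have hz0 : x - P x = 0 := inner_self_eq_zero.mp (Submodule.inner_right_of_mem_orthogonal h2 hz)
  exact Submodule.starProjection_eq_self_iff.mp (sub_eq_zero.mp hz0).symm

/-! ## 3. Goursat: the closed `G`-span of a vector with all components non-zero -/

section Goursat

variable {ι : Type*} [Fintype ι] {V : ι → Submodule ℂ H} {c : ι → H}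

omit [CompleteSpace H] in
/-- The inner product of the `j`-th component with the sum is its squared norm (pairwise orthogonality). -/
theorem inner_component_sum (horth : Pairwise fun i j => V i ⟂ V j) (hc : ∀ i, c i ∈ V i) (j : ι) :
    ⟪c j, ∑ i, c i⟫_ℂ = ⟪c j, c j⟫_ℂ := by
  rw [inner_sum, Finset.sum_eq_single j]
  · intro i _ hij
    exact Submodule.inner_right_of_mem_orthogonal (hc j) (Submodule.isOrtho_iff_le.mp (horth hij) (hc i))
  · intro h
    exact absurd (Finset.mem_univ j) h

/-- **Goursat.**  `V : ι → Submodule ℂ H` irreducible, pairwise orthogonal, pairwise non-equivalent; `cᵢ ∈ Vᵢ` all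
non-zero.  Then every `Vⱼ` lies in the closed `G`-span of `u' = ∑ cᵢ`. -/
theorem le_cyclic_sum (hR : IsUnitaryRep R) (hV : ∀ i, IsIrreducible R (V i))
    (horth : Pairwise fun i j => V i ⟂ V j) (hne : Pairwise fun i j => ¬ Equiv R (V i) (V j))
    (hc : ∀ i, c i ∈ V i) (hc0 : ∀ i, c i ≠ 0) (j : ι) : V j ≤ cyclic R (∑ i, c i) := by
  have hNc := isClosed_cyclic (R := R) (∑ i, c i)
  have hNinv := cyclic_invariant (R := R) (∑ i, c i)
  have hu'N := mem_cyclic_self (R := R) (∑ i, c i)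
  haveI : CompleteSpace (V j) := (hV j).isClosed.completeSpace_coe
  rcases (hV j).orthogonal_or_exists_equiv_le hR hNc hNinv with h | ⟨V', hV'N, hV', heq⟩
  · exfalso
    have h0 : ⟪c j, ∑ i, c i⟫_ℂ = 0 :=
      Submodule.inner_right_of_mem_orthogonal (hc j) (Submodule.isOrtho_iff_le.mp h.symm hu'N)
    rw [inner_component_sum horth hc j] at h0
    exact hc0 j (inner_self_eq_zero.mp h0)
  · -- `V'` is orthogonal to every other `Vᵢ` (inequivalence) …
    have hV'orth : ∀ i, i ≠ j → V' ⟂ V i := by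
      intro i hij
      rcases orthogonal_or_equiv hR hV' (hV i) with h | h
      · exact h
      · exact absurd (heq.trans h) (hne (Ne.symm hij))
    -- … and lies in the closure of `⨆ Vᵢ = Vⱼ ⊔ ⨆_{i ≠ j} Vᵢ` …
    have hsup_inv : Invariant R (⨆ i, V i) := Invariant.iSup fun i => (hV i).invariant
    have hNle : cyclic R (∑ i, c i) ≤ (⨆ i, V i).topologicalClosure :=
      cyclic_le (Submodule.isClosed_topologicalClosure _) hsup_inv.topologicalClosure
        (Submodule.le_topologicalClosure _
          (Submodule.sum_mem _ fun i _ => Submodule.mem_iSup_of_mem i (hc i)))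
    have hsplit : (⨆ i, V i) = V j ⊔ ⨆ (i) (_ : i ≠ j), V i := iSup_split_single V j
    have hjW : V j ⟂ ⨆ (i) (_ : i ≠ j), V i := by
      rw [Submodule.isOrtho_iSup_right]
      intro i
      rw [Submodule.isOrtho_iSup_right]
      intro hij
      exact horth (Ne.symm hij)
    have hV'W : V' ⟂ ⨆ (i) (_ : i ≠ j), V i := by
      rw [Submodule.isOrtho_iSup_right]
      intro i
      rw [Submodule.isOrtho_iSup_right]
      intro hij
      exact hV'orth i hij
    -- … hence `V' ≤ Vⱼ`, so `V' = Vⱼ` by irreducibility.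
    have hV'le : V' ≤ V j := by
      intro x hx
      have hx' : x ∈ (V j ⊔ ⨆ (i) (_ : i ≠ j), V i).topologicalClosure := by
        rw [← hsplit]
        exact hNle (hV'N hx)
      exact mem_of_mem_closure_sup_of_mem_orthogonal hjW hx' (Submodule.isOrtho_iff_le.mp hV'W hx)
    rcases (hV j).irred V' hV'le hV'.isClosed hV'.invariant with h | h
    · exact absurd h hV'.ne_bot
    · rw [← h]
      exact hV'N

/-- **The closed `G`-span of `u' = ∑ cᵢ` is the closure of `⨆ Vᵢ`.** -/
theorem cyclic_sum_eq (hR : IsUnitaryRep R) (hV : ∀ i, IsIrreducible R (V i))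
    (horth : Pairwise fun i j => V i ⟂ V j) (hne : Pairwise fun i j => ¬ Equiv R (V i) (V j))
    (hc : ∀ i, c i ∈ V i) (hc0 : ∀ i, c i ≠ 0) :
    cyclic R (∑ i, c i) = (⨆ i, V i).topologicalClosure := by
  refine le_antisymm ?_ ?_
  · exact cyclic_le (Submodule.isClosed_topologicalClosure _)
      (Invariant.iSup fun i => (hV i).invariant).topologicalClosure
      (Submodule.le_topologicalClosure _ (Submodule.sum_mem _ fun i _ => Submodule.mem_iSup_of_mem i (hc i)))
  · exact Submodule.topologicalClosure_minimal _ (iSup_le fun j => le_cyclic_sum hR hV horth hne hc hc0 j)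
      (isClosed_cyclic _)

end Goursat

/-! ## 4. Pairing -/

omit [CompleteSpace H] in
/-- A non-zero vector of the closed `G`-span of `u'` pairs non-trivially with some translate of `u'`. -/
theorem exists_inner_orbit_ne_zero_of_mem_cyclic {u u' : H} (hu : u ∈ cyclic R u') (hu0 : u ≠ 0) :
    ∃ g : G, ⟪R g u', u⟫_ℂ ≠ 0 := by
  by_contra h
  push Not at h
  have h1 : u ∈ (ℂ ∙ u)ᗮ := cyclic_le_orthogonal_of_inner_orbit_eq_zero h hu
  exact hu0 (inner_self_eq_zero.mp
    (Submodule.inner_right_of_mem_orthogonal (Submodule.mem_span_singleton_self u) h1))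

/-- **Pairing across a finite orthogonal sum of inequivalent irreducibles.**  With `V`, `c` as in `le_cyclic_sum`,
every non-zero `u ∈ closure (⨆ Vᵢ)` has `⟪R g (∑ cᵢ), u⟫ ≠ 0` for some `g`. -/
theorem exists_inner_orbit_sum_ne_zero {ι : Type*} [Fintype ι] {V : ι → Submodule ℂ H} {c : ι → H}
    (hR : IsUnitaryRep R) (hV : ∀ i, IsIrreducible R (V i)) (horth : Pairwise fun i j => V i ⟂ V j)
    (hne : Pairwise fun i j => ¬ Equiv R (V i) (V j)) (hc : ∀ i, c i ∈ V i) (hc0 : ∀ i, c i ≠ 0)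
    {u : H} (hu : u ∈ (⨆ i, V i).topologicalClosure) (hu0 : u ≠ 0) :
    ∃ g : G, ⟪R g (∑ i, c i), u⟫_ℂ ≠ 0 :=
  exists_inner_orbit_ne_zero_of_mem_cyclic (by rwa [cyclic_sum_eq hR hV horth hne hc hc0]) hu0

/-! ## 5. Pointwise support transfer to rational elements -/

omit [CompleteSpace H] in
/-- **Pointwise support transfer.**  If every `g` at which the matrix coefficient `⟪R g u', u⟫` is non-zero factors
as `g = k'γk` with `γ ∈ Λ`, `k` fixing `u'` and `k'` fixing `u`, then a non-vanishing coefficient is non-zero at some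
`γ ∈ Λ` (indeed `⟪R γ u', u⟫ = ⟪R g u', u⟫` by unitarity). -/
theorem exists_mem_inner_orbit_ne_zero_of_support (hR : IsUnitaryRep R) {Λ : Set G} {u u' : H}
    (hsupp : ∀ g : G, ⟪R g u', u⟫_ℂ ≠ 0 →
      ∃ k' : G, ∃ γ ∈ Λ, ∃ k : G, R k u' = u' ∧ R k' u = u ∧ g = k' * γ * k)
    (h : ∃ g : G, ⟪R g u', u⟫_ℂ ≠ 0) : ∃ γ ∈ Λ, ⟪R γ u', u⟫_ℂ ≠ 0 := by
  obtain ⟨g, hg⟩ := h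
  obtain ⟨k', γ, hγ, k, hk, hk', rfl⟩ := hsupp g hg
  refine ⟨γ, hγ, ?_⟩
  have hval : ⟪R (k' * γ * k) u', u⟫_ℂ = ⟪R γ u', u⟫_ℂ := by
    conv_lhs => rw [mul_apply', mul_apply', hk, ← hk', hR k' (R γ u') u]
  rwa [hval] at hg

/-- **The combination consumed by (I5)**: `V`, `c` as in `le_cyclic_sum`, `u ≠ 0` in `closure (⨆ Vᵢ)`, and the
pointwise support factorisation through `Λ` ⇒ some `γ ∈ Λ` pairs `∑ cᵢ` with `u`. -/
theorem exists_mem_inner_orbit_sum_ne_zero_of_support {ι : Type*} [Fintype ι] {V : ι → Submodule ℂ H}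
    {c : ι → H} (hR : IsUnitaryRep R) (hV : ∀ i, IsIrreducible R (V i))
    (horth : Pairwise fun i j => V i ⟂ V j) (hne : Pairwise fun i j => ¬ Equiv R (V i) (V j))
    (hc : ∀ i, c i ∈ V i) (hc0 : ∀ i, c i ≠ 0) {u : H} (hu : u ∈ (⨆ i, V i).topologicalClosure)
    (hu0 : u ≠ 0) {Λ : Set G}
    (hsupp : ∀ g : G, ⟪R g (∑ i, c i), u⟫_ℂ ≠ 0 →
      ∃ k' : G, ∃ γ ∈ Λ, ∃ k : G, R k (∑ i, c i) = ∑ i, c i ∧ R k' u = u ∧ g = k' * γ * k) :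
    ∃ γ ∈ Λ, ⟪R γ (∑ i, c i), u⟫_ℂ ≠ 0 :=
  exists_mem_inner_orbit_ne_zero_of_support hR hsupp (exists_inner_orbit_sum_ne_zero hR hV horth hne hc hc0 hu hu0)

/-! ## 6. In the language of isomorphism classes (members of DISTINCT classes) -/

section Classes

variable {ι : Type*} [Fintype ι]

omit [Fintype ι] in
/-- Members of distinct classes are pairwise orthogonal. -/
theorem pairwise_isOrtho_of_members (hR : IsUnitaryRep R) {cls : ι → IsoClass R}
    (hcls : Function.Injective cls) (W : ∀ i, Members R (cls i)) :
    Pairwise fun i j => (W i).1.1 ⟂ (W j).1.1 := fun _ _ hij =>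
  ((isotypic_orthogonal hR (hcls.ne hij)).mono_left (le_isotypic (W _))).mono_right (le_isotypic (W _))

omit [CompleteSpace H] [Fintype ι] in
/-- Members of distinct classes are pairwise non-equivalent. -/
theorem pairwise_not_equiv_of_members {cls : ι → IsoClass R} (hcls : Function.Injective cls)
    (W : ∀ i, Members R (cls i)) : Pairwise fun i j => ¬ Equiv R (W i).1.1 (W j).1.1 := fun i j hij h =>
  hij (hcls (((W i).2.symm.trans ((classOf_eq_classOf_iff (W i).1 (W j).1).mpr h)).trans (W j).2))

/-- **Pairing across members of finitely many DISTINCT isomorphism classes**: `cᵢ ∈ Wᵢ` all non-zero,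
`u ≠ 0` in `closure (⨆ Wᵢ)` ⇒ `⟪R g (∑ cᵢ), u⟫ ≠ 0` for some `g`.  (Multiplicity one is the DICTIONARY statement
that the relevant classes — the twists `[π ⊗ ψ∘det]` — are distinct and each `Wᵢ` is the whole isotypic
component; here only distinctness is used.) -/
theorem exists_inner_orbit_sum_ne_zero_of_members (hR : IsUnitaryRep R) {cls : ι → IsoClass R}
    (hcls : Function.Injective cls) (W : ∀ i, Members R (cls i)) {c : ι → H} (hc : ∀ i, c i ∈ (W i).1.1)
    (hc0 : ∀ i, c i ≠ 0) {u : H} (hu : u ∈ (⨆ i, ((W i).1.1 : Submodule ℂ H)).topologicalClosure)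
    (hu0 : u ≠ 0) : ∃ g : G, ⟪R g (∑ i, c i), u⟫_ℂ ≠ 0 :=
  exists_inner_orbit_sum_ne_zero hR (fun i => (W i).1.2) (pairwise_isOrtho_of_members hR hcls W)
    (pairwise_not_equiv_of_members hcls W) hc hc0 hu hu0

/-- … and with the pointwise support factorisation through `Λ`, some `γ ∈ Λ` pairs. -/
theorem exists_mem_inner_orbit_sum_ne_zero_of_members (hR : IsUnitaryRep R) {cls : ι → IsoClass R}
    (hcls : Function.Injective cls) (W : ∀ i, Members R (cls i)) {c : ι → H} (hc : ∀ i, c i ∈ (W i).1.1)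
    (hc0 : ∀ i, c i ≠ 0) {u : H} (hu : u ∈ (⨆ i, ((W i).1.1 : Submodule ℂ H)).topologicalClosure)
    (hu0 : u ≠ 0) {Λ : Set G}
    (hsupp : ∀ g : G, ⟪R g (∑ i, c i), u⟫_ℂ ≠ 0 →
      ∃ k' : G, ∃ γ ∈ Λ, ∃ k : G, R k (∑ i, c i) = ∑ i, c i ∧ R k' u = u ∧ g = k' * γ * k) :
    ∃ γ ∈ Λ, ⟪R γ (∑ i, c i), u⟫_ℂ ≠ 0 :=
  exists_mem_inner_orbit_ne_zero_of_support hR hsupp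
    (exists_inner_orbit_sum_ne_zero_of_members hR hcls W hc hc0 hu hu0)

end Classes

end RepDecomp
end HodgeCM

end
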